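import Mathlib
import Summits.Schanuel.Schanuel.Theses.AdelicLogSector
import Summits.Schanuel.Schanuel.Theses.BenfordTowers
import Summits.Schanuel.Schanuel.Theorems.RigidCoreSchanuelOnLogFreeCoreSectorGlue
import Literature.FieldTheory.TranscendenceDegree.AlgebraicDependenceBookkeeping
import Literature.NumberTheory.Transcendental.KirbyWeakSchanuelAx
import Literature.NumberTheory.Transcendental.GammaFieldsEcl
import HarnessLib

/-!
# `OffPrimeLogSector` reduces to exponentially-algebraic tuples (Kirby's `ecl ∅` reduction)

Support file for the crux `OffPrimeLogSector` (item stmt-Schanuel-7090; decl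
`Summit.Schanuel.Schanuel.Theses.AdelicLogSector.OffPrimeLogSector`, verbatim re-declared as
`Summit.Schanuel.Schanuel.Theses.BenfordTowers.OffPrimeLogSector`): Schanuel's conjecture RELATIVE
to the prime-log field `K₁ = ℚ(log p : p prime)` — for `x ∈ ℂⁿ` that is `ℚ`-free modulo
`V₁ = span_ℚ {log p : p prime}`, `n ≤ trdeg_{K₁} K₁(x, eˣ)`.

Everything is proved for an ARBITRARY set `P ⊆ ecl ∅` of exponentially-algebraic numbers in place
of the prime logarithms (base field `ℚ(P)`, freeness modulo `span_ℚ P`), then specialised to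
`P = {log p : p prime}` (`primeLogs_subset_ecl`: `exp (log p) = p`, and `ecl ∅` contains the
logarithms of its elements).  What is PROVED (no `sorry`, no definition, no named fact assumed):

* `relCount_of_free_mod_ecl` / `offPrimeLogSector_of_free_mod_ecl` — the UNCONDITIONAL regime of
  the crux: `n ≤ trdeg_{ℚ(P)} ℚ(P)(x, eˣ)` for every tuple `x` that is `ℚ`-free modulo Kirby's
  exponential-algebraic closure `ecl ∅ ⊇ P` (J. Kirby, *Exponential algebraicity in exponential
  fields*, Bull. LMS 42 (2010), Thm. 1.2 — in the tree the THEOREM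
  `Literature.NumberTheory.Transcendental.kirby_relative_schanuel_complex_holds` — base-changed
  DOWN from `ℚ(ecl ∅)` to `ℚ(P) ⊆ ℚ(ecl ∅)`).
* `relCount_of_onEcl` / `offPrimeLogSector_iff_onEcl` — the crux is EQUIVALENT to its restriction
  to tuples with ALL ENTRIES IN `ecl ∅` (a countable subfield of `ℂ`): Kirby's `GL_n(ℚ)` sector
  reduction (op. cit. §7, proof of Prop. 7.2) run over the bottom field `ℚ(P)`: for `x` free
  modulo `span_ℚ P` let `V = span_ℚ(x)`, `W = V ⊓ ecl ∅` with basis `y` (`k` vectors,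
  exponentially algebraic, free modulo `span_ℚ P`), `U` a complement of `W` in `V` with basis `z`
  (`m` vectors, free modulo `ecl ∅`), `k + m = n`; the restricted statement counts
  `k ≤ trdeg_{ℚ(P)} ℚ(P)(y, eʸ)`, Kirby's theorem counts
  `m ≤ trdeg_{ℚ(ecl ∅)} ℚ(ecl ∅)(z, eᶻ) ≤ trdeg_{ℚ(P)(y,eʸ)} ℚ(P)(y, eʸ)(z, eᶻ)` (base change
  down: `ℚ(P)(y, eʸ) ⊆ ℚ(ecl ∅)` because `ecl ∅` is an exp-closed field), and the tower law with
  `ℚ(P)(y, eʸ, z, eᶻ) ⊆ ℚ(P)(x, eˣ)^{alg}` gives `n ≤ trdeg_{ℚ(P)} ℚ(P)(x, eˣ)`.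
* the same for the `BenfordTowers` copy of the decl (`Iff.rfl`-equal to the `AdelicLogSector` one).

Consequence recorded in the strategist census of stmt-Schanuel-7090 (prose, not a Lean statement):
every instance of the crux decided today lies in the regime "free modulo `ecl ∅`", which is inside
the regime where Schanuel's conjecture itself is decided (Ax–Kirby); on tuples from `ecl ∅` —
where `1, πi, e, log 2, √2·log 2, …` live — no instance of the relative count over `K₁` is known.

Bookkeeping lemmas (`trdeg_adjoin_antitone_base'`, `disjoint_span_of_free`) are re-proved from the
registered birth skeleton `Cruxes/OffPrimeLogSector/Lines/birth.lean` (Cruxes files are not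
importable); the transcendence-degree API comes from
`Theorems/RigidCoreSchanuelOnLogFreeCoreSectorGlue.lean` (`SectorGlue.trdeg_add_trdeg_adjoin_le`,
`trdeg_adjoin_le_of_subset_algebraicClosure`, `exp_rat_mul_mem_algebraicClosure`).
-/

set_option linter.dupNamespace false

namespace Summit.Schanuel.Schanuel.Theorems.AdelicLogSector.EclReduction

open IntermediateField Complex Submodule Set Function Literature.FieldTheory.TranscendenceDegree
open Algebra (trdeg)
open Summit.Schanuel.Schanuel.Theorems.RigidCore.SectorGlue
open Literature.NumberTheory.Transcendental

/-! ## Bookkeeping lemmas -/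

/-- Base change DOWN only increases the transcendence degree generated by a finite set, across
different scalar fields: for subfields `F₁ ⊆ F₂` of `ℂ` (given as intermediate fields over
possibly different base fields) and finite `S`, `trdeg_{F₂} F₂(S) ≤ trdeg_{F₁} F₁(S)`
(re-proof of `Cruxes/OffPrimeLogSector/Lines/birth.lean`, same name). [folklore] -/
theorem trdeg_adjoin_antitone_base' {K K' : Type} [Field K] [Field K'] [Algebra K ℂ]
    [Algebra K' ℂ] (F₁ : IntermediateField K ℂ) (F₂ : IntermediateField K' ℂ)
    (h12 : ∀ w : ℂ, w ∈ F₁ → w ∈ F₂) (S : Set ℂ) (hS : S.Finite) :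
    trdeg F₂ (adjoin F₂ S) ≤ trdeg F₁ (adjoin F₁ S) := by
  obtain ⟨t, ht⟩ := (AlgebraicIndependent.matroid F₂ ℂ).exists_isBasis S
  obtain ⟨hti, hts, hta⟩ := AlgebraicIndependent.matroid_isBasis_iff.1 ht
  have htf := hS.subset hts
  have hle : adjoin F₂ S ≤ (algebraicClosure (adjoin F₂ t) ℂ).restrictScalars F₂ :=
    adjoin_le_iff.2 fun w hw => mem_algebraicClosure_iff.2 (isAlgebraic_adjoin_iff.2 (hta w hw))
  let φ : F₁ →+* F₂ :=
    { toFun := fun w => ⟨(w : ℂ), h12 _ w.2⟩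
      map_one' := rfl
      map_mul' := fun _ _ => rfl
      map_zero' := rfl
      map_add' := fun _ _ => rfl }
  letI : Algebra F₁ F₂ := φ.toAlgebra
  haveI : IsScalarTower F₁ F₂ ℂ := .of_algebraMap_eq fun _ => rfl
  have hφ : Function.Injective (algebraMap F₁ F₂) := fun a b h =>
    Subtype.ext (congrArg Subtype.val h :)
  calc trdeg F₂ (adjoin F₂ S) ≤ htf.toFinset.card :=
        trdeg_le_card_of_forall_isAlgebraic (adjoin F₂ S).toSubalgebra htf.toFinset
          fun w hw => by
            rw [htf.coe_toFinset, ← isAlgebraic_adjoin_iff]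
            exact mem_algebraicClosure_iff.1 (hle hw)
    _ = Cardinal.mk t := by rw [← ncard_eq_toFinset_card t htf, cast_ncard htf]
    _ ≤ _ := (AlgebraicIndependent.of_comp (adjoin F₁ S).val
        (x := fun i : t => (⟨i, subset_adjoin F₁ S (hts i.2)⟩ : adjoin F₁ S))
        (hti.restrictScalars hφ)).cardinalMk_le_trdeg

/-- Freeness modulo a subspace `N` makes `span_ℚ(x)` disjoint from `N`
(re-proof of `Cruxes/OffPrimeLogSector/Lines/birth.lean`, same name). [folklore] -/
theorem disjoint_span_of_free {n : ℕ} {x : Fin n → ℂ} (N : Submodule ℚ ℂ)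
    (hx : LinearIndependent ℚ (N.mkQ ∘ x)) : Disjoint (span ℚ (range x)) N := by
  rw [disjoint_def]
  intro u hu huN
  obtain ⟨c, rfl⟩ := (mem_span_range_iff_exists_fun ℚ).1 hu
  have h0 : ∑ i, c i • (N.mkQ ∘ x) i = 0 := by
    have : N.mkQ (∑ i, c i • x i) = 0 := (Submodule.Quotient.mk_eq_zero N).2 huN
    simpa [map_sum, map_smul] using this
  have hc := Fintype.linearIndependent_iff.1 hx c h0
  simp [hc]

/-- Elements of `span_ℚ(ecl ∅)` (`= ecl ∅`) and their exponentials lie in the field `ℚ(ecl ∅)`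
(`ecl ∅` is an exp-closed subfield, Kirby 2010, Lemma 3.3). [cite: Kirby2010, Lemma 3.3] -/
theorem mem_eclField_of_mem_span (w : ℂ) (hw : w ∈ span ℚ (ecl (∅ : Set ℂ))) :
    w ∈ adjoin ℚ (ecl (∅ : Set ℂ)) ∧ exp w ∈ adjoin ℚ (ecl (∅ : Set ℂ)) := by
  have hw' : w ∈ ecl (∅ : Set ℂ) := GammaField.mem_span_ecl_iff.1 hw
  exact ⟨subset_adjoin ℚ _ hw',
    subset_adjoin ℚ _ (Khovanskii.exp_mem_ecl hw' : exp w ∈ ecl (∅ : Set ℂ))⟩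

/-! ## The relative count over `ℚ(P)`, `P ⊆ ecl ∅` -/

/-- **Unconditional regime.** For any set `P ⊆ ecl ∅` of exponentially-algebraic numbers: if
`x₁, …, xₙ ∈ ℂ` are `ℚ`-linearly independent modulo `span_ℚ(ecl ∅)`, then
`n ≤ trdeg_{ℚ(P)} ℚ(P)(x, eˣ)` — Kirby's Theorem 1.2 (tree theorem
`kirby_relative_schanuel_complex_holds`) base-changed down from `ℚ(ecl ∅)` to `ℚ(P)`. PROVED.
[cite: Kirby2010, Thm. 1.2] -/
theorem relCount_of_free_mod_ecl (P : Set ℂ) (hP : P ⊆ ecl (∅ : Set ℂ)) (n : ℕ) (x : Fin n → ℂ)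
    (hx : LinearIndependent ℚ ((span ℚ (ecl (∅ : Set ℂ))).mkQ ∘ x)) :
    (n : Cardinal) ≤ trdeg (adjoin ℚ P) (adjoin (adjoin ℚ P) (range x ∪ range (exp ∘ x))) :=
  (kirby_relative_schanuel_complex_holds n x hx).trans
    (trdeg_adjoin_antitone_base' (adjoin ℚ P) (adjoin ℚ (ecl (∅ : Set ℂ)))
      (fun _ hw => adjoin.mono ℚ _ _ hP hw) _ ((finite_range x).union (finite_range _)))

/-- **Kirby's `ecl ∅` reduction over `ℚ(P)`** (PROVED). For any set `P ⊆ ecl ∅`: if the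
`ℚ(P)`-relative Schanuel count `k ≤ trdeg_{ℚ(P)} ℚ(P)(y, eʸ)` holds for all tuples `y` WITH
ENTRIES IN `ecl ∅` that are `ℚ`-free modulo `span_ℚ P`, then it holds for ALL tuples `x` that are
`ℚ`-free modulo `span_ℚ P`.  `GL_n(ℚ)` sector reduction along `E = span_ℚ(ecl ∅)` with Kirby's
Theorem 1.2 as the outside count (see the module docstring).
[cite: Kirby2010, Thm. 1.2 and proof of Prop. 7.2] -/
theorem relCount_of_onEcl (P : Set ℂ) (hP : P ⊆ ecl (∅ : Set ℂ))
    (hEcl : ∀ (k : ℕ) (y : Fin k → ℂ), (∀ i, y i ∈ ecl (∅ : Set ℂ)) →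
      LinearIndependent ℚ ((span ℚ P).mkQ ∘ y) →
      (k : Cardinal) ≤ trdeg (adjoin ℚ P) (adjoin (adjoin ℚ P) (range y ∪ range (exp ∘ y))))
    (n : ℕ) (x : Fin n → ℂ) (hx : LinearIndependent ℚ ((span ℚ P).mkQ ∘ x)) :
    (n : Cardinal) ≤ trdeg (adjoin ℚ P) (adjoin (adjoin ℚ P) (range x ∪ range (exp ∘ x))) := by
  have hAC : ∀ {R : Type} [Field R] [Algebra R ℂ] {w : ℂ},
      w ∈ algebraicClosure R ℂ ↔ IsAlgebraic R w := mem_algebraicClosure_iff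
  have hxli : LinearIndependent ℚ x := LinearIndependent.of_comp _ hx
  set E : Submodule ℚ ℂ := span ℚ (ecl (∅ : Set ℂ)) with hE
  set V : Submodule ℚ ℂ := span ℚ (range x) with hV
  haveI : FiniteDimensional ℚ V := FiniteDimensional.span_of_finite ℚ (finite_range x)
  obtain ⟨U', hU'⟩ := (V ⊓ E).exists_isCompl
  set W : Submodule ℚ ℂ := V ⊓ E
  set U : Submodule ℚ ℂ := V ⊓ U' with hU
  haveI : FiniteDimensional ℚ W := finiteDimensional_of_le inf_le_left
  haveI : FiniteDimensional ℚ U := finiteDimensional_of_le inf_le_left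
  have hsup : W ⊔ U = V := by
    rw [hU, inf_comm, ← sup_inf_assoc_of_le U' (inf_le_left : W ≤ V), hU'.sup_eq_top, top_inf_eq]
  have hdj : Disjoint W U := hU'.disjoint.mono_right inf_le_right
  set k := Module.finrank ℚ W
  set m := Module.finrank ℚ U
  have hn : k + m = n := by
    have h1 := finrank_sup_add_finrank_inf_eq W U
    rw [hdj.eq_bot, finrank_bot, add_zero, hsup, hV, finrank_span_eq_card hxli,
      Fintype.card_fin] at h1
    exact h1.symm
  let bW := Module.finBasis ℚ W
  let bU := Module.finBasis ℚ U
  let y : Fin k → ℂ := fun i => bW i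
  let z : Fin m → ℂ := fun j => bU j
  have hyli : LinearIndependent ℚ y := bW.linearIndependent.map' W.subtype W.ker_subtype
  have hzli : LinearIndependent ℚ z := bU.linearIndependent.map' U.subtype U.ker_subtype
  have hyE : ∀ i, y i ∈ E := fun i => (bW i).2.2
  have hyEcl : ∀ i, y i ∈ ecl (∅ : Set ℂ) := fun i => GammaField.mem_span_ecl_iff.1 (hyE i)
  have hyfree : LinearIndependent ℚ ((span ℚ P).mkQ ∘ y) := by
    refine hyli.map ?_
    rw [ker_mkQ]
    exact (disjoint_span_of_free _ hx).mono_left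
      (span_le.2 (range_subset_iff.2 fun i => (bW i).2.1))
  have hzE : LinearIndependent ℚ (E.mkQ ∘ z) := by
    refine hzli.map ?_
    rw [ker_mkQ, disjoint_def]
    intro u hu huE
    have huU : u ∈ U := span_le.2 (range_subset_iff.2 fun j => (bU j).2) hu
    exact disjoint_def.1 hdj u ⟨huU.1, huE⟩ huU
  set Sy := range y ∪ range (exp ∘ y)
  set Sz := range z ∪ range (exp ∘ z)
  set Ky := adjoin (adjoin ℚ P) Sy
  set Kx := adjoin (adjoin ℚ P) (range x ∪ range (exp ∘ x))
  have hPL : adjoin ℚ P ≤ adjoin ℚ (ecl (∅ : Set ℂ)) := adjoin.mono ℚ _ _ hP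
  have hKyL : ∀ w : ℂ, w ∈ Ky → w ∈ adjoin ℚ (ecl (∅ : Set ℂ)) := by
    intro w hw
    have hle : Ky ≤ IntermediateField.extendScalars hPL := adjoin_le_iff.2 (by
      rintro _ (⟨i, rfl⟩ | ⟨i, rfl⟩)
      · exact (mem_eclField_of_mem_span _ (hyE i)).1
      · exact (mem_eclField_of_mem_span _ (hyE i)).2)
    exact (IntermediateField.mem_extendScalars hPL).1 (hle hw)
  have hVK : ∀ a ∈ V, a ∈ Kx ∧ exp a ∈ algebraicClosure Kx ℂ := by
    intro a ha
    obtain ⟨c, rfl⟩ := (mem_span_range_iff_exists_fun ℚ).1 ha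
    refine ⟨sum_mem fun i _ => ?_, ?_⟩
    · rw [Rat.smul_def]
      exact mul_mem (SubfieldClass.ratCast_mem Kx _) (subset_adjoin (adjoin ℚ P) _ (.inl ⟨i, rfl⟩))
    · simp_rw [Rat.smul_def]
      rw [exp_sum]
      exact prod_mem fun i _ => exp_rat_mul_mem_algebraicClosure Kx _ _
        (hAC.2 (isAlgebraic_algebraMap (⟨_, subset_adjoin (adjoin ℚ P) _ (.inr ⟨i, rfl⟩)⟩ : Kx)))
  refine (show (n : Cardinal) = k + m by rw [← hn, Nat.cast_add]).trans_le ((add_le_add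
    (hEcl k y hyEcl hyfree) ((kirby_relative_schanuel_complex_holds m z hzE).trans
    (trdeg_adjoin_antitone_base' Ky (adjoin ℚ (ecl (∅ : Set ℂ))) hKyL Sz
      ((finite_range z).union (finite_range _))))).trans
    ((trdeg_add_trdeg_adjoin_le (adjoin ℚ P) Sy Sz).trans
    (trdeg_adjoin_le_of_subset_algebraicClosure (adjoin ℚ P) Kx _ ?_)))
  rintro w ((⟨i, rfl⟩ | ⟨i, rfl⟩) | (⟨j, rfl⟩ | ⟨j, rfl⟩))
  · exact hAC.2 (isAlgebraic_algebraMap (⟨_, (hVK _ (bW i).2.1).1⟩ : Kx))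
  · exact (hVK _ (bW i).2.1).2
  · exact hAC.2 (isAlgebraic_algebraMap (⟨_, (hVK _ (bU j).2.1).1⟩ : Kx))
  · exact (hVK _ (bU j).2.1).2

/-! ## The prime logarithms are exponentially algebraic -/

/-- `log p ∈ ecl ∅` for a prime `p` (indeed for any positive integer): `exp (log p) = p ∈ ecl ∅`
and `ecl ∅` contains the logarithms of its elements (Kirby 2010, Lemma 3.3; tree
`GammaField.mem_ecl_of_exp_mem`). [cite: Kirby2010, Lemma 3.3] -/
theorem logPrime_mem_ecl {p : ℕ} (hp : p.Prime) :
    ((Real.log (p : ℝ) : ℝ) : ℂ) ∈ ecl (∅ : Set ℂ) :=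
  GammaField.mem_ecl_of_exp_mem (C := (∅ : Set ℂ)) (by
    rw [show Literature.ModelTheory.ExponentialFields.ExponentialRing.exp
          ((Real.log (p : ℝ) : ℝ) : ℂ) = Complex.exp ((Real.log (p : ℝ) : ℝ) : ℂ) from rfl,
      ← Complex.ofReal_exp, Real.exp_log (by exact_mod_cast hp.pos), Complex.ofReal_natCast]
    exact natCast_mem (Khovanskii.eclSubfield (∅ : Set ℂ)) p)

/-- `{log p : p prime} ⊆ ecl ∅`. [cite: Kirby2010, Lemma 3.3] -/
theorem primeLogs_subset_ecl :
    {z : ℂ | ∃ p : ℕ, p.Prime ∧ z = ((Real.log (p : ℝ) : ℝ) : ℂ)} ⊆ ecl (∅ : Set ℂ) := by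
  rintro _ ⟨p, hp, rfl⟩
  exact logPrime_mem_ecl hp

/-! ## The crux `OffPrimeLogSector` -/

/-- **The proved regime of `OffPrimeLogSector`.** If `x₁, …, xₙ ∈ ℂ` are `ℚ`-linearly independent
modulo `span_ℚ(ecl ∅)` (stronger than modulo `V₁ = span_ℚ{log p}`), then
`n ≤ trdeg_{K₁} K₁(x, eˣ)`, `K₁ = ℚ(log p : p prime)`. PROVED (Kirby Thm. 1.2, base change down).
[cite: Kirby2010, Thm. 1.2] -/
theorem offPrimeLogSector_of_free_mod_ecl (n : ℕ) (x : Fin n → ℂ)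
    (hx : LinearIndependent ℚ ((Submodule.span ℚ (ecl (∅ : Set ℂ))).mkQ ∘ x)) :
    (n : Cardinal) ≤ Algebra.trdeg
        ↥(IntermediateField.adjoin ℚ {z : ℂ | ∃ p : ℕ, p.Prime ∧ z = ((Real.log (p : ℝ) : ℝ) : ℂ)})
        ↥(IntermediateField.adjoin
            ↥(IntermediateField.adjoin ℚ {z : ℂ | ∃ p : ℕ, p.Prime ∧ z = ((Real.log (p : ℝ) : ℝ) : ℂ)})
            (Set.range x ∪ Set.range (Complex.exp ∘ x))) :=
  relCount_of_free_mod_ecl _ primeLogs_subset_ecl n x hx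

/-- **`OffPrimeLogSector` from its restriction to exponentially-algebraic tuples** (the crux BY
NAME, route `AdelicLogSector` decl): if the `K₁`-relative Schanuel count holds for all tuples with
entries in `ecl ∅` that are free modulo `V₁`, then `OffPrimeLogSector`. PROVED.
[cite: Kirby2010, Thm. 1.2 and proof of Prop. 7.2] -/
theorem offPrimeLogSector_of_onEcl
    (hEcl : ∀ (k : ℕ) (y : Fin k → ℂ), (∀ i, y i ∈ ecl (∅ : Set ℂ)) →
      LinearIndependent ℚ ((Submodule.span ℚ
        {z : ℂ | ∃ p : ℕ, p.Prime ∧ z = ((Real.log (p : ℝ) : ℝ) : ℂ)}).mkQ ∘ y) →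
      (k : Cardinal) ≤ Algebra.trdeg
        ↥(IntermediateField.adjoin ℚ {z : ℂ | ∃ p : ℕ, p.Prime ∧ z = ((Real.log (p : ℝ) : ℝ) : ℂ)})
        ↥(IntermediateField.adjoin
            ↥(IntermediateField.adjoin ℚ {z : ℂ | ∃ p : ℕ, p.Prime ∧ z = ((Real.log (p : ℝ) : ℝ) : ℂ)})
            (Set.range y ∪ Set.range (Complex.exp ∘ y)))) :
    Summit.Schanuel.Schanuel.Theses.AdelicLogSector.OffPrimeLogSector :=
  fun n x hx => relCount_of_onEcl _ primeLogs_subset_ecl hEcl n x hx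

/-- The trivial converse: `OffPrimeLogSector` implies its restriction to tuples from `ecl ∅`.
[folklore] -/
theorem onEcl_of_offPrimeLogSector
    (h : Summit.Schanuel.Schanuel.Theses.AdelicLogSector.OffPrimeLogSector) :
    ∀ (k : ℕ) (y : Fin k → ℂ), (∀ i, y i ∈ ecl (∅ : Set ℂ)) →
      LinearIndependent ℚ ((Submodule.span ℚ
        {z : ℂ | ∃ p : ℕ, p.Prime ∧ z = ((Real.log (p : ℝ) : ℝ) : ℂ)}).mkQ ∘ y) →
      (k : Cardinal) ≤ Algebra.trdeg
        ↥(IntermediateField.adjoin ℚ {z : ℂ | ∃ p : ℕ, p.Prime ∧ z = ((Real.log (p : ℝ) : ℝ) : ℂ)})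
        ↥(IntermediateField.adjoin
            ↥(IntermediateField.adjoin ℚ {z : ℂ | ∃ p : ℕ, p.Prime ∧ z = ((Real.log (p : ℝ) : ℝ) : ℂ)})
            (Set.range y ∪ Set.range (Complex.exp ∘ y))) :=
  fun k y _ hy => h k y hy

/-- **`OffPrimeLogSector` ⟺ its restriction to tuples from the countable field `ecl ∅`**
(route `AdelicLogSector` decl). PROVED. [cite: Kirby2010, Thm. 1.2 and Prop. 7.2] -/
theorem offPrimeLogSector_iff_onEcl :
    Summit.Schanuel.Schanuel.Theses.AdelicLogSector.OffPrimeLogSector ↔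
    ∀ (k : ℕ) (y : Fin k → ℂ), (∀ i, y i ∈ ecl (∅ : Set ℂ)) →
      LinearIndependent ℚ ((Submodule.span ℚ
        {z : ℂ | ∃ p : ℕ, p.Prime ∧ z = ((Real.log (p : ℝ) : ℝ) : ℂ)}).mkQ ∘ y) →
      (k : Cardinal) ≤ Algebra.trdeg
        ↥(IntermediateField.adjoin ℚ {z : ℂ | ∃ p : ℕ, p.Prime ∧ z = ((Real.log (p : ℝ) : ℝ) : ℂ)})
        ↥(IntermediateField.adjoin
            ↥(IntermediateField.adjoin ℚ {z : ℂ | ∃ p : ℕ, p.Prime ∧ z = ((Real.log (p : ℝ) : ℝ) : ℂ)})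
            (Set.range y ∪ Set.range (Complex.exp ∘ y))) :=
  ⟨onEcl_of_offPrimeLogSector, offPrimeLogSector_of_onEcl⟩

/-! ## The `BenfordTowers` copy of the decl -/

/-- The two route files declare `OffPrimeLogSector` with the same body (item stmt-Schanuel-7090 is
shared by dedup): the decls are `Iff.rfl`-equal. [folklore] -/
theorem benfordTowers_offPrimeLogSector_iff :
    Summit.Schanuel.Schanuel.Theses.BenfordTowers.OffPrimeLogSector ↔
      Summit.Schanuel.Schanuel.Theses.AdelicLogSector.OffPrimeLogSector := Iff.rfl

/-- **`BenfordTowers.OffPrimeLogSector` ⟺ its restriction to tuples from `ecl ∅`.** PROVED.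
[cite: Kirby2010, Thm. 1.2 and Prop. 7.2] -/
theorem benfordTowers_offPrimeLogSector_iff_onEcl :
    Summit.Schanuel.Schanuel.Theses.BenfordTowers.OffPrimeLogSector ↔
    ∀ (k : ℕ) (y : Fin k → ℂ), (∀ i, y i ∈ ecl (∅ : Set ℂ)) →
      LinearIndependent ℚ ((Submodule.span ℚ
        {z : ℂ | ∃ p : ℕ, p.Prime ∧ z = ((Real.log (p : ℝ) : ℝ) : ℂ)}).mkQ ∘ y) →
      (k : Cardinal) ≤ Algebra.trdeg
        ↥(IntermediateField.adjoin ℚ {z : ℂ | ∃ p : ℕ, p.Prime ∧ z = ((Real.log (p : ℝ) : ℝ) : ℂ)})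
        ↥(IntermediateField.adjoin
            ↥(IntermediateField.adjoin ℚ {z : ℂ | ∃ p : ℕ, p.Prime ∧ z = ((Real.log (p : ℝ) : ℝ) : ℂ)})
            (Set.range y ∪ Set.range (Complex.exp ∘ y))) :=
  offPrimeLogSector_iff_onEcl

end Summit.Schanuel.Schanuel.Theorems.AdelicLogSector.EclReduction
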